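import Summits.QuantumFields.QCD.Theses.SpectralDefectExtinction
import Literature.MathematicalPhysics.QuantumFieldTheory.QCDPhaseQuenched
import Literature.MathematicalPhysics.QuantumFieldTheory.SpectralDefectDensity
import Literature.Barriers.QuantumFields.WilsonDeterminantMassSplitting

/-!
# Stub `countLeResolvent` of line `Sketch` (skeleton "ResolventCell") for crux
`SpectralDefectExtinction.WegnerEstimate` (item stmt-QuantumFields-8966)

For the Hermitian Wilson–Dirac operator `H = Γ₅ D_W(U, m₀, 1)` and `ε > 0`, the number of
eigenvalues in `(−ε, ε)` is at most `2ε · Im tr (H − iε)⁻¹`.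

Proof: for a Hermitian matrix `A = U diag(λ) U⋆` (spectral theorem) one has
`(A − iε)⁻¹ = U diag((λ_j − iε)⁻¹) U⋆`, so `Im tr (A − iε)⁻¹ = Σ_j ε / (λ_j² + ε²)`, while the
eigenvalue count is `Σ_j 1_{|λ_j| < ε}` and termwise `1_{|λ| < ε} ≤ 2ε · ε / (λ² + ε²)`.
-/

noncomputable section

namespace Summit.QuantumFields.QCD.Cruxes.WegnerEstimate.ResolventCell

open MeasureTheory
open scoped Matrix BigOperators
open Literature.MathematicalPhysics.QuantumLattice Literature.MathematicalPhysics.QuantumFieldTheory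
  Literature.Probability.LatticeModels
open Literature.Barriers.QuantumFields (isHermitian_gammaFive_mul_wilsonDirac)
open Matrix

/-- `Im (a − iε)⁻¹ = ε / (a² + ε²)` for real `a`, `ε`. -/
theorem countLeResolvent_inv_im (a ε : ℝ) :
    (((a : ℂ) - (ε : ℂ) * Complex.I)⁻¹).im = ε / (a ^ 2 + ε ^ 2) := by
  rw [Complex.inv_im, Complex.normSq_apply]
  simp only [Complex.sub_re, Complex.sub_im, Complex.ofReal_re, Complex.ofReal_im, Complex.mul_re,
    Complex.mul_im, Complex.I_re, Complex.I_im, mul_zero, mul_one, sub_zero, zero_sub, neg_neg]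
  ring

/-- The termwise Wegner bound `1_{|a| < ε} ≤ 2ε · ε / (a² + ε²)` for `ε > 0`. -/
theorem countLeResolvent_indicator_le (a ε : ℝ) (hε : 0 < ε) :
    (if |a| < ε then (1 : ℝ) else 0) ≤ 2 * ε * (ε / (a ^ 2 + ε ^ 2)) := by
  have hpos : 0 < a ^ 2 + ε ^ 2 := by positivity
  split_ifs with h
  · rw [← mul_div_assoc, le_div_iff₀ hpos, one_mul]
    have hlt : a ^ 2 < ε ^ 2 := sq_lt_sq' (abs_lt.1 h).1 (abs_lt.1 h).2
    nlinarith
  · positivity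

/-- **Resolvent bound on the eigenvalue count of a Hermitian matrix.**  For a Hermitian
`A : Matrix n n ℂ` and `ε > 0`, the number of roots of the characteristic polynomial with
`|Re z| < ε` (= number of eigenvalues in `(−ε, ε)`, with multiplicity) is at most
`2ε · Im tr (A − iε)⁻¹ = 2 Σ_j ε² / (λ_j² + ε²)`. -/
theorem countLeResolvent_of_isHermitian {n : Type*} [Fintype n] [DecidableEq n]
    {A : Matrix n n ℂ} (hA : A.IsHermitian) {ε : ℝ} (hε : 0 < ε) :
    (Multiset.countP (fun z : ℂ => |z.re| < ε) A.charpoly.roots : ℝ) ≤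
      2 * ε * ((A - ((ε : ℂ) * Complex.I) • (1 : Matrix n n ℂ))⁻¹).trace.im := by
  -- spectral decomposition
  set V : Matrix n n ℂ := (hA.eigenvectorUnitary : Matrix n n ℂ) with hVdef
  have hVmem := (hA.eigenvectorUnitary).2
  have hV1 : star V * V = 1 := Unitary.star_mul_self_of_mem hVmem
  have hV2 : V * star V = 1 := Unitary.mul_star_self_of_mem hVmem
  have hspec : A = V * diagonal (RCLike.ofReal ∘ hA.eigenvalues) * star V := hA.spectral_theorem
  -- the shifted diagonal
  set d : n → ℂ := fun j => ((hA.eigenvalues j : ℝ) : ℂ) - (ε : ℂ) * Complex.I with hd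
  have hd_ne : ∀ j, d j ≠ 0 := by
    intro j h
    have him := congrArg Complex.im h
    simp only [hd, Complex.sub_im, Complex.ofReal_im, Complex.mul_im, Complex.ofReal_re,
      Complex.I_im, Complex.I_re, mul_one, mul_zero, add_zero, zero_sub, Complex.zero_im,
      neg_eq_zero] at him
    exact hε.ne' him
  have hdiag : diagonal (RCLike.ofReal ∘ hA.eigenvalues) - ((ε : ℂ) * Complex.I) • (1 : Matrix n n ℂ) =
      diagonal d := by
    rw [smul_one_eq_diagonal, diagonal_sub, hd]
    rfl
  have hshift : A - ((ε : ℂ) * Complex.I) • (1 : Matrix n n ℂ) = V * diagonal d * star V := by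
    rw [← hdiag, Matrix.mul_sub, Matrix.sub_mul, Matrix.mul_smul, Matrix.mul_one, Matrix.smul_mul,
      hV2, ← hspec]
  have hinv : (A - ((ε : ℂ) * Complex.I) • (1 : Matrix n n ℂ))⁻¹ =
      V * diagonal (fun j => (d j)⁻¹) * star V := by
    apply Matrix.inv_eq_right_inv
    rw [hshift]
    have hdd : diagonal d * diagonal (fun j => (d j)⁻¹) = (1 : Matrix n n ℂ) := by
      rw [diagonal_mul_diagonal, ← diagonal_one]
      congr 1
      funext j
      exact mul_inv_cancel₀ (hd_ne j)
    calc V * diagonal d * star V * (V * diagonal (fun j => (d j)⁻¹) * star V)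
        = V * (diagonal d * (star V * V) * diagonal (fun j => (d j)⁻¹)) * star V := by
          simp only [Matrix.mul_assoc]
      _ = 1 := by rw [hV1, Matrix.mul_one, hdd, Matrix.mul_one, hV2]
  have htrace : ((A - ((ε : ℂ) * Complex.I) • (1 : Matrix n n ℂ))⁻¹).trace.im =
      ∑ j, ε / (hA.eigenvalues j ^ 2 + ε ^ 2) := by
    rw [hinv, trace_mul_cycle, hV1, Matrix.one_mul, trace_diagonal, Complex.im_sum]
    refine Finset.sum_congr rfl fun j _ => ?_
    rw [hd]
    exact countLeResolvent_inv_im (hA.eigenvalues j) ε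
  -- the count as a sum of indicators
  have hcount : (Multiset.countP (fun z : ℂ => |z.re| < ε) A.charpoly.roots : ℝ) =
      ∑ j, if |hA.eigenvalues j| < ε then (1 : ℝ) else 0 := by
    rw [hA.roots_charpoly_eq_eigenvalues, Multiset.countP_map, ← Finset.filter_val, Finset.card_val,
      Finset.natCast_card_filter]
    refine Finset.sum_congr rfl fun j _ => ?_
    simp
  rw [hcount, htrace, Finset.mul_sum]
  exact Finset.sum_le_sum fun j _ => countLeResolvent_indicator_le (hA.eigenvalues j) ε hε

/-- **Stub `countLeResolvent` (deterministic; ideator 3's `CountLeResolvent`).**  For the Hermitian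
Wilson–Dirac operator `H = Γ₅ D_W(U, m₀, 1)` and `ε > 0`, the number of eigenvalues in `(−ε, ε)` is at most
`2ε · Im tr (H − iε)⁻¹ = 2 Σ_j ε²/(λ_j² + ε²)` (spectral theorem, `1_{|λ|<ε} ≤ 2ε²/(λ²+ε²)`). -/
theorem stub_countLeResolvent (L : ℕ) [NeZero L] (U : GaugeConfig 4 L SU3) (m₀ ε : ℝ) (hε : 0 < ε) :
    (Multiset.countP (fun z : ℂ => |z.re| < ε)
        (spinorLift gammaFive * wilsonDirac (fundamentalRep (Fin 3)) U m₀ 1).charpoly.roots : ℝ) ≤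
      2 * ε * ((spinorLift gammaFive * wilsonDirac (fundamentalRep (Fin 3)) U m₀ 1 -
        ((ε : ℂ) * Complex.I) • (1 : Matrix (QuarkIdx L) (QuarkIdx L) ℂ))⁻¹).trace.im :=
  countLeResolvent_of_isHermitian
    (isHermitian_gammaFive_mul_wilsonDirac (fundamentalRep (Fin 3)) fundamentalRep_mem_unitaryGroup U m₀ 1)
    hε

end Summit.QuantumFields.QCD.Cruxes.WegnerEstimate.ResolventCell

end
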